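import Summits.QuantumFields.QCD.Theses.PauliWegnerSea
import Literature.MathematicalPhysics.QuantumFieldTheory.QCDPhaseQuenchedReweighting
import Summits.QuantumFields.QCD.Theorems.PauliWegnerSeaGluonicCompletionHaarWordIterate
import Summits.QuantumFields.QCD.Theorems.PauliWegnerSeaGluonicCompletionHaarCurveStep
import Summits.QuantumFields.QCD.Theorems.PauliWegnerSeaGluonicCompletionDetAlongLinkCurve
import Summits.QuantumFields.QCD.Theorems.PauliWegnerSeaGluonicCompletionSu3CircleWord

/-!
# Crux `GluonicCompletion` (stmt-QuantumFields-9152), line `finite-sign-budget-at-the-scheme-volume` — stub `stub_detNonvanishing`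

Assembly of the a.e. non-vanishing of the `N_f`-flavour Wilson determinant from the three landed infrastructure
stubs of the line (imported): the right-invariant averaging step
(`stub_haarCurveStep`), the trigonometric structure of `θ ↦ det D(U·δ_e(c θ)·V)` (`stub_detAlongLinkCurve`) and
the generation of `SU(3)` by nine circle letters (`stub_su3CircleWord`); the trigonometric dichotomy, the
iteration of the averaging step and the surjectivity of the one-link words are the landed helper stubs
`stub_trigDichotomy`, `stub_haarWordIterate`, `stub_linkWordSurjective` (`…HaarWordIterate.lean`).

Proof.  Work on `G = GaugeConfig 4 S SU(3)` (pointwise group) with `μ` = product Haar (finite, right invariant)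
and the family of closed sets `Z_H = {U | ∀ h ∈ H, det D(U·h) = 0}`, `H ⊆ G`.  Along every one-link circle
`c = δ_e ∘ c₀` with trigonometric entries, every `Z_H` satisfies the dichotomy of the averaging step (the
determinant along the circle is `p(e^{iθ})e^{-iNθ}`, which vanishes identically or on the countable, hence null,
set `{θ | p(e^{iθ}) = 0}`), and `{g | ∀ θ, g·c(θ) ∈ Z_H} = Z_{c(ℝ)·H}` stays in the family; iterating the step
over the list of all `9 · #edges` letters gives `μ(Z_{1}) = μ{U | ∀ word w, U·w ∈ Z_{1}}`.  Every `V ∈ G` is a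
word (it is the product over the edges of `δ_e(V_e)`, and each `V_e ∈ SU(3)` is a nine-letter word), so the
right-hand set is empty as soon as one configuration has `det D ≠ 0`.  Finally `μ_W = Z⁻¹e^{−βS_W}·μ ≪ μ`.
-/

noncomputable section

namespace Summit.QuantumFields.QCD.Theorems.FiniteSignBudgetAtTheSchemeVolume

open scoped BigOperators Topology ENNReal
open MeasureTheory Filter Complex
open Literature.MathematicalPhysics.QuantumFieldTheory Literature.MathematicalPhysics.QuantumLattice
  Literature.Probability.LatticeModels

/-! ### The four circles: membership in `SU(3)`, continuity, trigonometric entries -/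

/-- `conj (e^{ix}) = e^{-ix}` for real `x`. [folklore] -/
private theorem conj_cexp (x : ℝ) : (starRingEnd ℂ) (cexp (x * I)) = cexp (-(x * I)) := by
  rw [← Complex.exp_conj, map_mul, Complex.conj_ofReal, Complex.conj_I, mul_neg]

/-- `conj (e^{-ix}) = e^{ix}` for real `x`. [folklore] -/
private theorem conj_cexp_neg (x : ℝ) : (starRingEnd ℂ) (cexp (-(x * I))) = cexp (x * I) := by
  rw [← Complex.exp_conj, map_neg, map_mul, Complex.conj_ofReal, Complex.conj_I, mul_neg, neg_neg]

/-- `e^{ix} e^{-ix} = 1`. [folklore] -/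
private theorem cexp_mul_cexp_neg (x : ℝ) : cexp (x * I) * cexp (-(x * I)) = 1 := by
  rw [← Complex.exp_add, add_neg_cancel, Complex.exp_zero]

/-- `e^{-ix} e^{ix} = 1`. [folklore] -/
private theorem cexp_neg_mul_cexp (x : ℝ) : cexp (-(x * I)) * cexp (x * I) = 1 := by
  rw [mul_comm, cexp_mul_cexp_neg]

/-- `cos² + sin² = 1` in `ℂ`, product form. [folklore] -/
private theorem cos_mul_cos_add_sin_mul_sin (x : ℝ) :
    Complex.cos x * Complex.cos x + Complex.sin x * Complex.sin x = 1 := by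
  have := Complex.cos_sq_add_sin_sq (x : ℂ)
  simpa only [sq] using this

/-- The phase circle `P₁₂(θ) = diag(1, e^{iθ}, e^{-iθ})` lies in `SU(3)`. [folklore] -/
private theorem mem_P12 (θ : ℝ) :
    !![(1 : ℂ), 0, 0; 0, cexp (θ * I), 0; 0, 0, cexp (-(θ * I))] ∈
      Matrix.specialUnitaryGroup (Fin 3) ℂ := by
  rw [Matrix.mem_specialUnitaryGroup_iff, Matrix.mem_unitaryGroup_iff']
  constructor
  · ext i j
    fin_cases i <;> fin_cases j <;>
      simp [Matrix.mul_apply, Fin.sum_univ_three, conj_cexp, conj_cexp_neg, cexp_mul_cexp_neg,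
        cexp_neg_mul_cexp]
  · rw [Matrix.det_fin_three]
    simp [cexp_mul_cexp_neg]

/-- The phase circle `P₀₁(θ) = diag(e^{iθ}, e^{-iθ}, 1)` lies in `SU(3)`. [folklore] -/
private theorem mem_P01 (θ : ℝ) :
    !![cexp (θ * I), 0, 0; 0, cexp (-(θ * I)), 0; 0, 0, (1 : ℂ)] ∈
      Matrix.specialUnitaryGroup (Fin 3) ℂ := by
  rw [Matrix.mem_specialUnitaryGroup_iff, Matrix.mem_unitaryGroup_iff']
  constructor
  · ext i j
    fin_cases i <;> fin_cases j <;>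
      simp [Matrix.mul_apply, Fin.sum_univ_three, conj_cexp, conj_cexp_neg, cexp_mul_cexp_neg,
        cexp_neg_mul_cexp]
  · rw [Matrix.det_fin_three]
    simp [cexp_mul_cexp_neg]

/-- The rotation circle `R₁₂(θ)` of the coordinates `(1,2)` lies in `SU(3)`. [folklore] -/
private theorem mem_R12 (θ : ℝ) :
    !![(1 : ℂ), 0, 0; 0, (Real.cos θ : ℂ), -(Real.sin θ : ℂ); 0, (Real.sin θ : ℂ), (Real.cos θ : ℂ)] ∈
      Matrix.specialUnitaryGroup (Fin 3) ℂ := by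
  have h := cos_mul_cos_add_sin_mul_sin θ
  rw [Matrix.mem_specialUnitaryGroup_iff, Matrix.mem_unitaryGroup_iff']
  constructor
  · ext i j
    fin_cases i <;> fin_cases j <;>
      simp [Matrix.mul_apply, Fin.sum_univ_three, ← Complex.cos_conj, ← Complex.sin_conj,
        Complex.conj_ofReal]
    all_goals first | linear_combination h | ring
  · rw [Matrix.det_fin_three]
    simp
    linear_combination h

/-- The rotation circle `R₀₁(θ)` of the coordinates `(0,1)` lies in `SU(3)`. [folklore] -/
private theorem mem_R01 (θ : ℝ) :
    !![(Real.cos θ : ℂ), -(Real.sin θ : ℂ), 0; (Real.sin θ : ℂ), (Real.cos θ : ℂ), 0; 0, 0, (1 : ℂ)] ∈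
      Matrix.specialUnitaryGroup (Fin 3) ℂ := by
  have h := cos_mul_cos_add_sin_mul_sin θ
  rw [Matrix.mem_specialUnitaryGroup_iff, Matrix.mem_unitaryGroup_iff']
  constructor
  · ext i j
    fin_cases i <;> fin_cases j <;>
      simp [Matrix.mul_apply, Fin.sum_univ_three, ← Complex.cos_conj, ← Complex.sin_conj,
        Complex.conj_ofReal]
    all_goals first | linear_combination h | ring
  · rw [Matrix.det_fin_three]
    simp
    linear_combination h

/-! ### Trigonometric entries of the letters -/

/-- `1` is a trigonometric polynomial. [folklore] -/
private theorem trig_one : ∃ (N : ℕ) (p : Polynomial ℂ), ∀ θ : ℝ,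
    (1 : ℂ) = p.eval (cexp (θ * I)) * cexp (-(N * θ * I)) :=
  ⟨0, 1, fun θ => by simp⟩

/-- `0` is a trigonometric polynomial. [folklore] -/
private theorem trig_zero : ∃ (N : ℕ) (p : Polynomial ℂ), ∀ θ : ℝ,
    (0 : ℂ) = p.eval (cexp (θ * I)) * cexp (-(N * θ * I)) :=
  ⟨0, 0, fun θ => by simp⟩

/-- `e^{iθ}` is a trigonometric polynomial. [folklore] -/
private theorem trig_exp : ∃ (N : ℕ) (p : Polynomial ℂ), ∀ θ : ℝ,
    cexp (θ * I) = p.eval (cexp (θ * I)) * cexp (-(N * θ * I)) :=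
  ⟨0, Polynomial.X, fun θ => by simp⟩

/-- `e^{-iθ}` is a trigonometric polynomial. [folklore] -/
private theorem trig_exp_neg : ∃ (N : ℕ) (p : Polynomial ℂ), ∀ θ : ℝ,
    cexp (-(θ * I)) = p.eval (cexp (θ * I)) * cexp (-(N * θ * I)) :=
  ⟨1, 1, fun θ => by simp⟩

/-- `cos θ = (e^{2iθ} + 1) e^{-iθ}/2` is a trigonometric polynomial. [folklore] -/
private theorem trig_cos : ∃ (N : ℕ) (p : Polynomial ℂ), ∀ θ : ℝ,
    (Real.cos θ : ℂ) = p.eval (cexp (θ * I)) * cexp (-(N * θ * I)) := by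
  refine ⟨1, Polynomial.C (1 / 2 : ℂ) * (Polynomial.X ^ 2 + 1), fun θ => ?_⟩
  rw [Complex.ofReal_cos, Complex.cos]
  simp only [Polynomial.eval_mul, Polynomial.eval_C, Polynomial.eval_add, Polynomial.eval_pow,
    Polynomial.eval_X, Polynomial.eval_one, Nat.cast_one, one_mul]
  have h1 := cexp_mul_cexp_neg θ
  have h2 : cexp (↑θ * I) ^ 2 * cexp (-(↑θ * I)) = cexp (↑θ * I) := by
    rw [sq, mul_assoc, h1, mul_one]
  rw [neg_mul]
  linear_combination (-(1 / 2 : ℂ)) * h2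

/-- `sin θ = i(1 − e^{2iθ}) e^{-iθ}/2` is a trigonometric polynomial. [folklore] -/
private theorem trig_sin : ∃ (N : ℕ) (p : Polynomial ℂ), ∀ θ : ℝ,
    (Real.sin θ : ℂ) = p.eval (cexp (θ * I)) * cexp (-(N * θ * I)) := by
  refine ⟨1, Polynomial.C (I / 2) * (1 - Polynomial.X ^ 2), fun θ => ?_⟩
  rw [Complex.ofReal_sin, Complex.sin]
  simp only [Polynomial.eval_mul, Polynomial.eval_C, Polynomial.eval_sub, Polynomial.eval_pow,
    Polynomial.eval_X, Polynomial.eval_one, Nat.cast_one, one_mul]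
  have h1 := cexp_mul_cexp_neg θ
  have h2 : cexp (↑θ * I) ^ 2 * cexp (-(↑θ * I)) = cexp (↑θ * I) := by
    rw [sq, mul_assoc, h1, mul_one]
  rw [neg_mul]
  linear_combination (I / 2) * h2

/-- `-sin θ` is a trigonometric polynomial. [folklore] -/
private theorem trig_neg_sin : ∃ (N : ℕ) (p : Polynomial ℂ), ∀ θ : ℝ,
    -(Real.sin θ : ℂ) = p.eval (cexp (θ * I)) * cexp (-(N * θ * I)) := by
  obtain ⟨N, p, hp⟩ := trig_sin
  exact ⟨N, -p, fun θ => by rw [hp θ, Polynomial.eval_neg, neg_mul]⟩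

/-- The entries of `P₁₂(θ)` are trigonometric polynomials. [folklore] -/
private theorem trig_P12 (a b : Fin 3) : ∃ (N : ℕ) (p : Polynomial ℂ), ∀ θ : ℝ,
    (!![(1 : ℂ), 0, 0; 0, cexp (θ * I), 0; 0, 0, cexp (-(θ * I))] : Matrix (Fin 3) (Fin 3) ℂ) a b =
      p.eval (cexp (θ * I)) * cexp (-(N * θ * I)) := by
  fin_cases a <;> fin_cases b <;> simp only [Fin.zero_eta, Fin.isValue, Fin.mk_one, Fin.reduceFinMk,
    Matrix.of_apply, Matrix.cons_val', Matrix.cons_val_zero, Matrix.cons_val_one, Matrix.cons_val,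
    Matrix.cons_val_fin_one, Matrix.empty_val'] <;>
  first | exact trig_one | exact trig_zero | exact trig_exp | exact trig_exp_neg

/-- The entries of `P₀₁(θ)` are trigonometric polynomials. [folklore] -/
private theorem trig_P01 (a b : Fin 3) : ∃ (N : ℕ) (p : Polynomial ℂ), ∀ θ : ℝ,
    (!![cexp (θ * I), 0, 0; 0, cexp (-(θ * I)), 0; 0, 0, (1 : ℂ)] : Matrix (Fin 3) (Fin 3) ℂ) a b =
      p.eval (cexp (θ * I)) * cexp (-(N * θ * I)) := by
  fin_cases a <;> fin_cases b <;> simp only [Fin.zero_eta, Fin.isValue, Fin.mk_one, Fin.reduceFinMk,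
    Matrix.of_apply, Matrix.cons_val', Matrix.cons_val_zero, Matrix.cons_val_one, Matrix.cons_val,
    Matrix.cons_val_fin_one, Matrix.empty_val'] <;>
  first | exact trig_one | exact trig_zero | exact trig_exp | exact trig_exp_neg

/-- The entries of `R₁₂(θ)` are trigonometric polynomials. [folklore] -/
private theorem trig_R12 (a b : Fin 3) : ∃ (N : ℕ) (p : Polynomial ℂ), ∀ θ : ℝ,
    (!![(1 : ℂ), 0, 0; 0, (Real.cos θ : ℂ), -(Real.sin θ : ℂ); 0, (Real.sin θ : ℂ), (Real.cos θ : ℂ)] :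
        Matrix (Fin 3) (Fin 3) ℂ) a b =
      p.eval (cexp (θ * I)) * cexp (-(N * θ * I)) := by
  fin_cases a <;> fin_cases b <;> simp only [Fin.zero_eta, Fin.isValue, Fin.mk_one, Fin.reduceFinMk,
    Matrix.of_apply, Matrix.cons_val', Matrix.cons_val_zero, Matrix.cons_val_one, Matrix.cons_val,
    Matrix.cons_val_fin_one, Matrix.empty_val'] <;>
  first | exact trig_one | exact trig_zero | exact trig_cos | exact trig_sin | exact trig_neg_sin

/-- The entries of `R₀₁(θ)` are trigonometric polynomials. [folklore] -/
private theorem trig_R01 (a b : Fin 3) : ∃ (N : ℕ) (p : Polynomial ℂ), ∀ θ : ℝ,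
    (!![(Real.cos θ : ℂ), -(Real.sin θ : ℂ), 0; (Real.sin θ : ℂ), (Real.cos θ : ℂ), 0; 0, 0, (1 : ℂ)] :
        Matrix (Fin 3) (Fin 3) ℂ) a b =
      p.eval (cexp (θ * I)) * cexp (-(N * θ * I)) := by
  fin_cases a <;> fin_cases b <;> simp only [Fin.zero_eta, Fin.isValue, Fin.mk_one, Fin.reduceFinMk,
    Matrix.of_apply, Matrix.cons_val', Matrix.cons_val_zero, Matrix.cons_val_one, Matrix.cons_val,
    Matrix.cons_val_fin_one, Matrix.empty_val'] <;>
  first | exact trig_one | exact trig_zero | exact trig_cos | exact trig_sin | exact trig_neg_sin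

/-! ### Continuity of the letters -/

/-- Continuity of the phase circle `P₁₂`. [folklore] -/
private theorem continuous_P12 : Continuous fun θ : ℝ =>
    (⟨!![(1 : ℂ), 0, 0; 0, cexp (θ * I), 0; 0, 0, cexp (-(θ * I))], mem_P12 θ⟩ : SU3) := by
  refine Continuous.subtype_mk (continuous_pi fun a => continuous_pi fun b => ?_) _
  fin_cases a <;> fin_cases b <;> simp <;> fun_prop

/-- Continuity of the phase circle `P₀₁`. [folklore] -/
private theorem continuous_P01 : Continuous fun θ : ℝ =>
    (⟨!![cexp (θ * I), 0, 0; 0, cexp (-(θ * I)), 0; 0, 0, (1 : ℂ)], mem_P01 θ⟩ : SU3) := by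
  refine Continuous.subtype_mk (continuous_pi fun a => continuous_pi fun b => ?_) _
  fin_cases a <;> fin_cases b <;> simp <;> fun_prop

/-- Continuity of the rotation circle `R₁₂`. [folklore] -/
private theorem continuous_R12 : Continuous fun θ : ℝ =>
    (⟨!![(1 : ℂ), 0, 0; 0, (Real.cos θ : ℂ), -(Real.sin θ : ℂ); 0, (Real.sin θ : ℂ), (Real.cos θ : ℂ)],
      mem_R12 θ⟩ : SU3) := by
  refine Continuous.subtype_mk (continuous_pi fun a => continuous_pi fun b => ?_) _
  fin_cases a <;> fin_cases b <;> simp <;> fun_prop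

/-- Continuity of the rotation circle `R₀₁`. [folklore] -/
private theorem continuous_R01 : Continuous fun θ : ℝ =>
    (⟨!![(Real.cos θ : ℂ), -(Real.sin θ : ℂ), 0; (Real.sin θ : ℂ), (Real.cos θ : ℂ), 0; 0, 0, (1 : ℂ)],
      mem_R01 θ⟩ : SU3) := by
  refine Continuous.subtype_mk (continuous_pi fun a => continuous_pi fun b => ?_) _
  fin_cases a <;> fin_cases b <;> simp <;> fun_prop

/-! ### The assembly -/

/-- **Stub 1 — a.e. non-vanishing of the Wilson determinant** (assembly of the landed stubs 1a `stub_haarCurveStep`,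
1b `stub_detAlongLinkCurve`, 1c `stub_su3CircleWord` and the helper sub-goals of `…HaarWordIterate.lean`): on every torus, for every coupling and all bare
masses, if one configuration has `det D ≠ 0` then `det D ≠ 0` for `μ_W`-almost every gauge field.  With
`G = GaugeConfig 4 S SU(3)`, `μ` = product Haar and the family `Z_H = {U | ∀ h ∈ H, det D(U·h) = 0}`: 1b and
the trigonometric dichotomy give 1a's hypothesis for every `Z_H` along every one-link circle, the averaged set
`{g | ∀ θ, g·c(θ) ∈ Z_H} = Z_{c(ℝ)·H}` stays in the family, iterating over all `9·#edges` letters gives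
`μ(Z_{1}) = μ{U | ∀ words w, U·w ∈ Z_{1}} = μ(∅) = 0` (every `V ∈ G` is a word by 1c), and `μ_W ≪ μ`. [folklore] -/
theorem stub_detNonvanishing :
    ∀ (Nf S : ℕ) [NeZero S] (β : ℝ) (mq : Fin Nf → ℝ),
      (∃ U₀ : GaugeConfig 4 S SU3, (diracMatrix U₀ mq).det ≠ 0) →
        ∀ᵐ U : GaugeConfig 4 S SU3 ∂(wilsonMeasure (fundamentalRep (Fin 3)) β), (diracMatrix U mq).det ≠ 0 := by
  intro Nf S _ β mq hex
  obtain ⟨U₀, hU₀⟩ := hex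
  -- the nine letters
  let L : Fin 9 → ℝ → SU3 :=
    ![fun θ => ⟨_, mem_P12 θ⟩, fun θ => ⟨_, mem_R12 θ⟩, fun θ => ⟨_, mem_P12 θ⟩,
      fun θ => ⟨_, mem_P01 θ⟩, fun θ => ⟨_, mem_R01 θ⟩, fun θ => ⟨_, mem_P01 θ⟩,
      fun θ => ⟨_, mem_P12 θ⟩, fun θ => ⟨_, mem_R12 θ⟩, fun θ => ⟨_, mem_P12 θ⟩]
  have hLc : ∀ j, Continuous (L j) := by
    intro j
    fin_cases j
    exacts [continuous_P12, continuous_R12, continuous_P12, continuous_P01, continuous_R01,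
      continuous_P01, continuous_P12, continuous_R12, continuous_P12]
  have hLt : ∀ (j : Fin 9) (a b : Fin 3), ∃ (N : ℕ) (p : Polynomial ℂ), ∀ θ : ℝ,
      ((L j θ : SU3) : Matrix (Fin 3) (Fin 3) ℂ) a b = p.eval (cexp (θ * I)) * cexp (-(N * θ * I)) := by
    intro j a b
    fin_cases j
    exacts [trig_P12 a b, trig_R12 a b, trig_P12 a b, trig_P01 a b, trig_R01 a b, trig_P01 a b,
      trig_P12 a b, trig_R12 a b, trig_P12 a b]
  have hLgen : ∀ x : SU3, ∃ θ : Fin 9 → ℝ,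
      x = L 0 (θ 0) * L 1 (θ 1) * L 2 (θ 2) * L 3 (θ 3) * L 4 (θ 4) * L 5 (θ 5) * L 6 (θ 6) * L 7 (θ 7) *
        L 8 (θ 8) := by
    intro x
    obtain ⟨θ, hθ⟩ := stub_su3CircleWord (x : Matrix (Fin 3) (Fin 3) ℂ) x.2
    exact ⟨θ, Subtype.ext hθ⟩
  -- product Haar measure, the family of zero sets and the one-link curves
  set μ : Measure (GaugeConfig 4 S SU3) := Measure.pi fun _ : Edge 4 S => haarProbability SU3 with hμ
  let P : Set (GaugeConfig 4 S SU3) → Prop := fun Z =>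
    ∃ H : Set (GaugeConfig 4 S SU3), Z = {U | ∀ h ∈ H, (diracMatrix (U * h) mq).det = 0}
  let Q : (ℝ → GaugeConfig 4 S SU3) → Prop := fun c =>
    Continuous c ∧ ∃ (e : Edge 4 S) (c₀ : ℝ → SU3),
      (∀ a b : Fin 3, ∃ (N : ℕ) (p : Polynomial ℂ), ∀ θ : ℝ,
        (c₀ θ : Matrix (Fin 3) (Fin 3) ℂ) a b = p.eval (cexp (θ * I)) * cexp (-(N * θ * I))) ∧
      c = fun θ => Pi.mulSingle e (c₀ θ)
  have hP : ∀ Z, P Z → IsClosed Z := by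
    rintro Z ⟨H, rfl⟩
    have hZ : {U : GaugeConfig 4 S SU3 | ∀ h ∈ H, (diracMatrix (U * h) mq).det = 0} =
        ⋂ h ∈ H, {U | (diracMatrix (U * h) mq).det = 0} := by
      ext U; simp
    rw [hZ]
    exact isClosed_biInter fun h _ =>
      isClosed_eq ((continuous_det_diracMatrix mq).comp (continuous_id.mul continuous_const)) continuous_const
  have hdich : ∀ Z, P Z → ∀ c, Q c → ∀ g : GaugeConfig 4 S SU3,
      (∀ θ : ℝ, g * c θ ∈ Z) ∨ volume {θ : ℝ | g * c θ ∈ Z} = 0 := by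
    rintro Z ⟨H, rfl⟩ c ⟨-, e, c₀, hc₀, rfl⟩ g
    by_cases hall : ∀ h ∈ H, ∀ θ : ℝ, (diracMatrix (g * Pi.mulSingle e (c₀ θ) * h) mq).det = 0
    · left
      intro θ
      simp only [Set.mem_setOf_eq]
      exact fun h hh => hall h hh θ
    · right
      push Not at hall
      obtain ⟨h, hh, θ₁, hθ₁⟩ := hall
      obtain ⟨N, p, hp⟩ := stub_detAlongLinkCurve Nf S mq g h e c₀ hc₀
      rcases stub_trigDichotomy N p with hzero | hnull
      · exact absurd ((hp θ₁).trans (hzero θ₁)) hθ₁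
      · refine measure_mono_null (fun θ hθ => ?_) hnull
        simp only [Set.mem_setOf_eq] at hθ ⊢
        rw [← hp θ]
        exact hθ h hh
  have hstab : ∀ Z, P Z → ∀ c, Q c → P {g | ∀ θ : ℝ, g * c θ ∈ Z} := by
    rintro Z ⟨H, rfl⟩ c ⟨-, e, c₀, -, rfl⟩
    refine ⟨{k | ∃ θ : ℝ, ∃ h ∈ H, k = Pi.mulSingle e (c₀ θ) * h}, ?_⟩
    ext g
    simp only [Set.mem_setOf_eq]
    constructor
    · rintro hg k ⟨θ, h, hh, rfl⟩
      rw [← mul_assoc]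
      exact hg θ h hh
    · intro hg θ h hh
      have := hg (Pi.mulSingle e (c₀ θ) * h) ⟨θ, h, hh, rfl⟩
      rwa [← mul_assoc] at this
  have hQ : ∀ c, Q c → Continuous c := fun c hc => hc.1
  -- all letters on all links
  set cs : List (ℝ → GaugeConfig 4 S SU3) := (Finset.univ : Finset (Edge 4 S)).toList.flatMap fun e =>
    List.ofFn fun j : Fin 9 => fun θ : ℝ => (Pi.mulSingle e (L j θ) : GaugeConfig 4 S SU3) with hcs
  have hcsQ : ∀ c ∈ cs, Q c := by
    intro c hc
    simp only [hcs, List.mem_flatMap, List.mem_ofFn] at hc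
    obtain ⟨e, -, j, rfl⟩ := hc
    exact ⟨(continuous_mulSingle e).comp (hLc j), e, L j, hLt j, rfl⟩
  -- the zero set of the determinant and its average over all words
  have hPZ : P {U | (diracMatrix U mq).det = 0} := ⟨{1}, by ext U; simp⟩
  obtain ⟨-, hμZ⟩ := stub_haarWordIterate _ μ (fun c hc Z hZ hd => stub_haarCurveStep _ μ c hc Z hZ hd) P Q hQ hP hdich hstab
    cs hcsQ _ hPZ
  have hempty : {g : GaugeConfig 4 S SU3 | ∀ θs : List ℝ, θs.length = cs.length →
      g * (List.zipWith (fun c θ => c θ) cs θs).prod ∈ {U | (diracMatrix U mq).det = 0}} = ∅ := by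
    ext g
    simp only [Set.mem_setOf_eq, Set.mem_empty_iff_false, iff_false, not_forall]
    obtain ⟨θs, hlen, hprod⟩ := stub_linkWordSurjective S L hLgen (g⁻¹ * U₀)
    refine ⟨θs, hlen, ?_⟩
    rw [hprod, mul_inv_cancel_left]
    exact hU₀
  rw [hempty, measure_empty] at hμZ
  -- the Wilson measure is absolutely continuous with respect to the product Haar measure
  rw [ae_iff]
  simp only [ne_eq, not_not]
  simp only [wilsonMeasure, Measure.smul_apply, smul_eq_mul, wilsonWeight]
  have h0 : (Measure.pi fun _ : Edge 4 S => haarProbability SU3) {U | (diracMatrix U mq).det = 0} = 0 := by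
    rw [← hμ]
    exact hμZ
  rw [withDensity_absolutelyContinuous _ _ h0, mul_zero]

end Summit.QuantumFields.QCD.Theorems.FiniteSignBudgetAtTheSchemeVolume

end
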